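import Literature.NumberTheory.GaloisCohomology.KolyvaginSystems
import Summits.BirchSwinnertonDyer.Rank1Residual.GaloisImage.KolyvaginCoreVertices
import Literature.NumberTheory.GaloisRepresentations.ContinuousCupProductCompat
import HarnessLib

/-!
# Transport of Selmer-structure invariants along an equivariant bijection `e : T ⥲ T̄` — FILE F1a
# (cell `b2b-bsdres`, team n1011, seat p16 GEN 6; row T-R1-56-F1 = third seat of p13's T-R1-56-S
# 'S24(1) @ m = 1 IN THE KERNEL', skeleton `cells/n1011/skel/T-R1-56-F1.md`, referee-1 ACK-1 GEN 20)

HONEST FRAMING (cell `b2b-bsdres`, run/shared/lean/b2b/bsd-rank1-residual/, verbatim in every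
file): the goal of the cell is to DELETE the COMBINATION-SHAPED residual classes of the
Birch–Swinnerton-Dyer formula for ALL analytic-rank `≤ 1` elliptic curves over `ℚ` — "full BSD
formula for every rank `≤ 1` curve in class `C`" assembled STRICTLY from published theorems — so
that the rank-`≤ 1` remainder becomes exactly the CONSTRUCTION-SHAPED classes, which are TYPED
(missing-input `Prop`s), NOT attempted. This is not "finishing BSD". Team n1011 (N10 / N11 / O7):
research route on the CONSTRUCTION-SHAPED class X4 (N11 = X4 ∧ p = 3); prove what is provable now; no
claim beyond stated classes; TOOL theorems about Selmer structures of finite Galois modules; nothing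
booked; no mark / label moved. THEOREMS ONLY: no definition, no named fact, no `sorry`.

## What (Sakamoto 2024 §2 p. 921 "induced structure"; Mazur–Rubin functoriality; Howard Def. 2.1.6/2.1.10)

Let `e : M → M̄` be a continuous `Γ_K`-equivariant map of finite discrete `Γ_K`-modules (`K` any
number field) with a two-sided inverse `e'` — carried, in the definition-free style of X11b's
`WeilTransport` / p11's `KolyvaginCoreVertices` §3, as two intertwining maps with the pointwise
identities `hee' : e' (e a) = a`, `he'e : e (e' b) = b`; and on the dual side two intertwining maps
`eD : M̄^D → M^D`, `eD' : M^D → M̄^D` (`M^D = Hom(M, μₙ)`) with the pointwise formulas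
`heD : (eD f) a = f (e a)`, `heD' : (eD' g) b = g (e' b)` (FILE F1b constructs `eD := tateDualComap e`).
For a Selmer structure `𝓕` on `M` and its induced structure `𝓕̄ = 𝓕.induced e` on `M̄`:
* §A functoriality helpers (`map_comp_apply`, `map_bijective_of_inverse`, local twins);
* §B (T1) `localMap_mem_induced_iff`, `map_mem_selmerGroup_induced_iff`,
  **`natCard_selmerGroup_induced_eq : #H¹_{𝓕̄}(K, M̄) = #H¹_𝓕(K, M)`**, `induced_induced_eq_self`;
* §C (T2) `localTatePairingZMod_localMap_left` (`⟨H¹(e_v) a, y⟩_v = ⟨a, H¹(eD_v) y⟩_v`, adjoint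
  naturality of the cup product), `mem_dualLocalCondition_induced_iff`,
  `map_mem_dualSelmerGroup_induced_iff`,
  **`natCard_dualSelmerGroup_induced_eq : #H¹_{𝓕̄^*}(K, M̄^D) = #H¹_{𝓕^*}(K, M^D)`**, and the
  corollaries `hasCoreRank_induced_iff` (`χ(𝓕̄) = r ↔ χ(𝓕) = r`), `selmerLambda_induced_eq`,
  `lambdaStar_induced_eq`, `dualSelmerGroup_induced_eq_bot_iff`.
(T3) irreducibility, (T4) residual coisotropy and the `Nat.log` form are in FILE F1a′
`SelmerStructureTransportCoisotropic.lean`. Customer: p13's FILE F (`red : T ↠ T̄` at `m = 1` is a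
bijection with inverse `incl`). No duality theorem is used (pure transport): no `IsPerfect` /
`SumLocalTermEqZero` / `UnramifiedOrthogonal`, no `Fact p.Prime`, no hypothesis on `S`.

References: [Sakamoto2024] §2 (p. 921), §3.1.1, Def. 3.6 (p. 923); [Howard2004HeegnerKolyvagin]
Def. 2.1.6, 2.1.10; [NeukirchSchmidtWingberg2008] I §4 (1.4.2) (adjoint naturality);
[MilneADT2006] I §2. Tree precedents: X11b `WeilTransport` §1–§3, p11 `KolyvaginCoreVertices` §3
(`natCard_selmerGroup_dualTransported_eq`), `KummerSelfDualCount`.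
-/

noncomputable section

open scoped Classical

open Function NumberField IsDedekindDomain Field
open Literature.NumberTheory.GaloisRepresentations
open Literature.NumberTheory.GaloisRepresentations.DiscreteGaloisModule
open Literature.NumberTheory.GaloisCohomology
open Summit.BirchSwinnertonDyer.Rank1Residual.X11b.Levels
open Summit.BirchSwinnertonDyer.Rank1Residual.GaloisImage.CoreRankZero (localization_map_one_eq)
open scoped ContRepresentation

universe u

namespace Summit.BirchSwinnertonDyer.Rank1Residual.GaloisImage.Transport

/-! ## §A Functoriality helpers -/

section Generic

variable {F : Type u} [Field F] {M₁ M₂ M₃ : Type u}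
  [AddCommGroup M₁] [TopologicalSpace M₁] [DiscreteTopology M₁]
  [AddCommGroup M₂] [TopologicalSpace M₂] [DiscreteTopology M₂]
  [AddCommGroup M₃] [TopologicalSpace M₃] [DiscreteTopology M₃]
  {ρ₁ : DiscreteGaloisModule F M₁} {ρ₂ : DiscreteGaloisModule F M₂} {ρ₃ : DiscreteGaloisModule F M₃}

/-- `H¹(g ∘ f) = H¹(g) ∘ H¹(f)` on classes. [folklore] -/
theorem map_comp_apply (f : ρ₁.toContRepresentation →ⁱL ρ₂.toContRepresentation)
    (g : ρ₂.toContRepresentation →ⁱL ρ₃.toContRepresentation) (x : galoisCohomology ρ₁ 1) :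
    galoisCohomology.map (g.comp f) 1 x =
      galoisCohomology.map g 1 (galoisCohomology.map f 1 x) := by
  obtain ⟨φ, rfl⟩ := oneCocycleClass_surjective _ x
  rw [galoisCohomology.map_one_oneCocycleClass, galoisCohomology.map_one_oneCocycleClass,
    galoisCohomology.map_one_oneCocycleClass]
  rfl

/-- `H¹(e)` is bijective when `e` has a two-sided inverse `e'`. [folklore] -/
theorem map_bijective_of_inverse (e : ρ₁.toContRepresentation →ⁱL ρ₂.toContRepresentation)
    (e' : ρ₂.toContRepresentation →ⁱL ρ₁.toContRepresentation) (hee' : ∀ a, e' (e a) = a)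
    (he'e : ∀ b, e (e' b) = b) : Function.Bijective (galoisCohomology.map e 1) :=
  ⟨map_injective_of_comp_eq e e' hee',
    fun y => ⟨galoisCohomology.map e' 1 y, map_map_eq_self_of_comp_eq e' e he'e y⟩⟩

end Generic


/-! ## §B (T1) The Selmer group of the induced structure along a bijection -/

section Induced

variable {K : Type u} [Field K] [NumberField K] {M Mbar : Type u}
  [AddCommGroup M] [TopologicalSpace M] [DiscreteTopology M]
  [AddCommGroup Mbar] [TopologicalSpace Mbar] [DiscreteTopology Mbar]
  {ρ : DiscreteGaloisModule K M} {ρbar : DiscreteGaloisModule K Mbar}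
  (e : ρ.toContRepresentation →ⁱL ρbar.toContRepresentation)
  (e' : ρbar.toContRepresentation →ⁱL ρ.toContRepresentation)

/-- `H¹(e'_v) (H¹(e_v) x) = x` on `H¹(K_v, M)` when `e' ∘ e = id`. [folklore] -/
theorem localMap_localMap_eq_self (hee' : ∀ a, e' (e a) = a) (v : Place K)
    (x : galoisCohomology (ρ.toLocal v) 1) : localMap e' v (localMap e v x) = x :=
  map_map_eq_self_of_comp_eq (ρ₁ := ρ.toLocal v) (ρ₂ := ρbar.toLocal v) _ _ hee' x

/-- `H¹(e_v)` is injective when `e' ∘ e = id`. [folklore] -/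
theorem localMap_injective (hee' : ∀ a, e' (e a) = a) (v : Place K) :
    Function.Injective (localMap e v) :=
  Function.LeftInverse.injective (g := localMap e' v) (localMap_localMap_eq_self e e' hee' v)

/-- `localMap (g.comp f) v = localMap g v ∘ localMap f v`. [folklore] -/
theorem localMap_comp_apply {N : Type u} [AddCommGroup N] [TopologicalSpace N] [DiscreteTopology N]
    {ρ' : DiscreteGaloisModule K N} (f : ρ.toContRepresentation →ⁱL ρbar.toContRepresentation)
    (g : ρbar.toContRepresentation →ⁱL ρ'.toContRepresentation) (v : Place K)
    (x : galoisCohomology (ρ.toLocal v) 1) :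
    localMap (g.comp f) v x = localMap g v (localMap f v x) :=
  map_comp_apply (ρ₁ := ρ.toLocal v) (ρ₂ := ρbar.toLocal v) (ρ₃ := ρ'.toLocal v)
    (f.restrictField (Place.Completion v)) (g.restrictField (Place.Completion v)) x

variable (𝓕 : SelmerStructure ρ)

/-- **The induced local condition along a bijection**: `H¹(e_v) x ∈ 𝓕̄_v ↔ x ∈ 𝓕_v` for
`𝓕̄ = 𝓕.induced e` (`←`: definition of the induced structure; `→`: `H¹(e_v)` is injective).
[cite: Sakamoto2024, §2 (p. 921)] -/
theorem localMap_mem_induced_iff (hee' : ∀ a, e' (e a) = a) (v : Place K)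
    (x : galoisCohomology (ρ.toLocal v) 1) :
    localMap e v x ∈ 𝓕.induced e v ↔ x ∈ 𝓕 v := by
  rw [SelmerStructure.mem_induced_iff]
  refine ⟨fun ⟨y, hy, hyx⟩ => ?_, fun hx => ⟨x, hx, rfl⟩⟩
  rwa [← localMap_injective e e' hee' v hyx]

/-- **`H¹(e)` carries `H¹_𝓕(K, M)` onto `H¹_{𝓕̄}(K, M̄)`** (membership form): for `x ∈ H¹(K, M)`,
`H¹(e) x ∈ H¹_{𝓕.induced e} ↔ x ∈ H¹_𝓕` (localisation commutes with `H¹(e)`,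
`localization_map_one_eq`). [cite: Sakamoto2024, §2 (p. 921)] -/
theorem map_mem_selmerGroup_induced_iff (hee' : ∀ a, e' (e a) = a) (x : galoisCohomology ρ 1) :
    galoisCohomology.map e 1 x ∈ (𝓕.induced e).selmerGroup ↔ x ∈ 𝓕.selmerGroup := by
  simp only [SelmerStructure.mem_selmerGroup_iff, localization_map_one_eq]
  exact forall_congr' fun v => localMap_mem_induced_iff e e' 𝓕 hee' v _

/-- **(T1) `#H¹_{𝓕̄}(K, M̄) = #H¹_𝓕(K, M)`** for `𝓕̄ = 𝓕.induced e` along an equivariant bijection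
`e` (inverse `e'`): `H¹(e)` restricts to a bijection of Selmer groups (inverse `H¹(e')`).
[cite: Sakamoto2024, §2 (p. 921)] -/
theorem natCard_selmerGroup_induced_eq (hee' : ∀ a, e' (e a) = a) (he'e : ∀ b, e (e' b) = b) :
    Nat.card (𝓕.induced e).selmerGroup = Nat.card 𝓕.selmerGroup := by
  symm
  refine Nat.card_eq_of_bijective
    (fun x => ⟨galoisCohomology.map e 1 x.1, (map_mem_selmerGroup_induced_iff e e' 𝓕 hee' x.1).2 x.2⟩)
    ⟨fun x y hxy => Subtype.ext (map_injective_of_comp_eq e e' hee' (congrArg Subtype.val hxy)),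
      fun y => ⟨⟨galoisCohomology.map e' 1 y.1, ?_⟩,
        Subtype.ext (map_map_eq_self_of_comp_eq e' e he'e y.1)⟩⟩
  rw [← map_mem_selmerGroup_induced_iff e e' 𝓕 hee', map_map_eq_self_of_comp_eq e' e he'e]
  exact y.2

/-- The induced structure of the induced structure along the inverse is the original one:
`(𝓕.induced e).induced e' = 𝓕`. [folklore] -/
theorem induced_induced_eq_self (hee' : ∀ a, e' (e a) = a) : (𝓕.induced e).induced e' = 𝓕 := by
  funext v
  ext x
  rw [SelmerStructure.mem_induced_iff]
  refine ⟨fun ⟨y, hy, hyx⟩ => ?_, fun hx => ⟨localMap e v x, ?_, localMap_localMap_eq_self e e' hee' v x⟩⟩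
  · obtain ⟨z, hz, rfl⟩ := (SelmerStructure.mem_induced_iff 𝓕 e v y).1 hy
    rwa [← hyx, localMap_localMap_eq_self e e' hee']
  · exact (localMap_mem_induced_iff e e' 𝓕 hee' v x).2 hx

end Induced


/-! ## §C (T2) The dual Selmer structure of the induced structure -/

section Dual

variable {K : Type u} [Field K] [NumberField K] {M Mbar : Type u}
  [AddCommGroup M] [TopologicalSpace M] [DiscreteTopology M] [Finite M]
  [AddCommGroup Mbar] [TopologicalSpace Mbar] [DiscreteTopology Mbar] [Finite Mbar]
  {ρ : DiscreteGaloisModule K M} {ρbar : DiscreteGaloisModule K Mbar} {n : ℕ}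
  (e : ρ.toContRepresentation →ⁱL ρbar.toContRepresentation)
  (e' : ρbar.toContRepresentation →ⁱL ρ.toContRepresentation)
  (eD : (ρbar.tateDual n).toContRepresentation →ⁱL (ρ.tateDual n).toContRepresentation)
  (eD' : (ρ.tateDual n).toContRepresentation →ⁱL (ρbar.tateDual n).toContRepresentation)

/-- **Adjointness of `e` and its dual map `eD` under the local Tate pairings**:
`⟨H¹(e_v) a, y⟩_v = ⟨a, H¹(eD_v) y⟩_v` for `a ∈ H¹(K_v, M)`, `y ∈ H¹(K_v, M̄^D)`, whenever
`(eD f)(a) = f(e a)` pointwise (adjoint naturality of the cup product,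
`ContPairing.cupProduct_adjoint`). [cite: NeukirchSchmidtWingberg2008, I §4 (1.4.2)] -/
theorem localTatePairingZMod_localMap_left (heD : ∀ (f : TateDual K Mbar n) (a : M), eD f a = f (e a))
    (v : Place K) (inv : galoisCohomology ((mu K n).toLocal v) 2 →+ ZMod n)
    (a : galoisCohomology (ρ.toLocal v) 1) (y : galoisCohomology ((ρbar.tateDual n).toLocal v) 1) :
    localTatePairingZMod ρbar n v inv (localMap e v a) y =
      localTatePairingZMod ρ n v inv a (localMap eD v y) := by
  haveI := absoluteGaloisGroup_compactSpace (Place.Completion v)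
  rw [DiscreteGaloisModule.localTatePairingZMod_apply, DiscreteGaloisModule.localTatePairingZMod_apply]
  congr 1
  exact ContPairing.cupProduct_adjoint (tateDualPairingLocal ρ n v) (tateDualPairingLocal ρbar n v)
    (DiscreteGaloisModule.homOfIntertwining (e.restrictField (Place.Completion v)))
    (DiscreteGaloisModule.homOfIntertwining (eD.restrictField (Place.Completion v)))
    (fun x f => (heD f x).symm) a y

variable (inv : LocalInvariants K n) (𝓕 : SelmerStructure ρ)

/-- **The dual local condition of the induced condition corresponds under `H¹(eD_v)`**:
`y ∈ (𝓕̄_v)^* ↔ H¹(eD_v) y ∈ (𝓕_v)^*` (`𝓕̄ = 𝓕.induced e`; by adjointness, as `𝓕̄_v = H¹(e_v)(𝓕_v)`).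
[cite: Howard2004HeegnerKolyvagin, Def. 2.1.6 (arXiv:1202.6340 p. 5)] -/
theorem mem_dualLocalCondition_induced_iff (heD : ∀ (f : TateDual K Mbar n) (a : M), eD f a = f (e a))
    (v : Place K) (y : galoisCohomology ((ρbar.tateDual n).toLocal v) 1) :
    y ∈ inv.dualLocalCondition ρbar v (𝓕.induced e v) ↔
      localMap eD v y ∈ inv.dualLocalCondition ρ v (𝓕 v) := by
  simp only [LocalInvariants.mem_dualLocalCondition_iff, SelmerStructure.mem_induced_iff]
  refine ⟨fun h a ha => ?_, fun h x ⟨a, ha, hax⟩ => ?_⟩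
  · rw [← localTatePairingZMod_localMap_left e eD heD]
    exact h _ ⟨a, ha, rfl⟩
  · rw [← hax, localTatePairingZMod_localMap_left e eD heD]
    exact h a ha

/-- **`H¹(eD)` carries the dual Selmer group of `𝓕̄` into/onto that of `𝓕`** (membership form):
`y ∈ H¹_{𝓕̄^*}(K, M̄^D) ↔ H¹(eD) y ∈ H¹_{𝓕^*}(K, M^D)`.
[cite: Howard2004HeegnerKolyvagin, Def. 2.1.10 (arXiv:1202.6340 p. 6)] -/
theorem map_mem_dualSelmerGroup_induced_iff (heD : ∀ (f : TateDual K Mbar n) (a : M), eD f a = f (e a))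
    (y : galoisCohomology (ρbar.tateDual n) 1) :
    y ∈ (inv.dualSelmerStructure ρbar (𝓕.induced e)).selmerGroup ↔
      galoisCohomology.map eD 1 y ∈ (inv.dualSelmerStructure ρ 𝓕).selmerGroup := by
  simp only [SelmerStructure.mem_selmerGroup_iff, localization_map_one_eq,
    LocalInvariants.dualSelmerStructure_apply]
  exact forall_congr' fun v => mem_dualLocalCondition_induced_iff e eD inv 𝓕 heD v _

omit [NumberField K] in
/-- `eD' ∘ eD = id` pointwise, from the pointwise formulas and `e ∘ e' = id`. [folklore] -/
theorem dual_comp_eq_self (he'e : ∀ b, e (e' b) = b)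
    (heD : ∀ (f : TateDual K Mbar n) (a : M), eD f a = f (e a))
    (heD' : ∀ (g : TateDual K M n) (b : Mbar), eD' g b = g (e' b)) (f : TateDual K Mbar n) :
    eD' (eD f) = f :=
  TateDual.ext fun b => by rw [heD', heD, he'e]

/-- **(T2) `#H¹_{𝓕̄^*}(K, M̄^D) = #H¹_{𝓕^*}(K, M^D)`** for `𝓕̄ = 𝓕.induced e` along an equivariant
bijection `e` (inverse `e'`) with dual maps `eD`, `eD'` (pointwise `(eD f)(a) = f(e a)`,
`(eD' g)(b) = g(e' b)`): `H¹(eD)` restricts to a bijection of dual Selmer groups (inverse `H¹(eD')`).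
[cite: Howard2004HeegnerKolyvagin, Def. 2.1.10 (arXiv:1202.6340 p. 6)] -/
theorem natCard_dualSelmerGroup_induced_eq (hee' : ∀ a, e' (e a) = a) (he'e : ∀ b, e (e' b) = b)
    (heD : ∀ (f : TateDual K Mbar n) (a : M), eD f a = f (e a))
    (heD' : ∀ (g : TateDual K M n) (b : Mbar), eD' g b = g (e' b)) :
    Nat.card (inv.dualSelmerStructure ρbar (𝓕.induced e)).selmerGroup =
      Nat.card (inv.dualSelmerStructure ρ 𝓕).selmerGroup := by
  have h₁ : ∀ f, eD' (eD f) = f := dual_comp_eq_self e e' eD eD' he'e heD heD'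
  have h₂ : ∀ g, eD (eD' g) = g := dual_comp_eq_self e' e eD' eD hee' heD' heD
  refine Nat.card_eq_of_bijective
    (fun y => ⟨galoisCohomology.map eD 1 y.1,
      (map_mem_dualSelmerGroup_induced_iff e eD inv 𝓕 heD y.1).1 y.2⟩)
    ⟨fun x y hxy => Subtype.ext (map_injective_of_comp_eq eD eD' h₁ (congrArg Subtype.val hxy)),
      fun z => ⟨⟨galoisCohomology.map eD' 1 z.1, ?_⟩,
        Subtype.ext (map_map_eq_self_of_comp_eq eD' eD h₂ z.1)⟩⟩
  rw [map_mem_dualSelmerGroup_induced_iff e eD inv 𝓕 heD, map_map_eq_self_of_comp_eq eD' eD h₂]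
  exact z.2

/-- **Core rank is invariant**: `χ(𝓕̄) = r ↔ χ(𝓕) = r` in the log-free form `HasCoreRank`
(T1 + T2). [cite: Sakamoto2024, Def. 3.6 (p. 923)] -/
theorem hasCoreRank_induced_iff (hee' : ∀ a, e' (e a) = a) (he'e : ∀ b, e (e' b) = b)
    (heD : ∀ (f : TateDual K Mbar n) (a : M), eD f a = f (e a))
    (heD' : ∀ (g : TateDual K M n) (b : Mbar), eD' g b = g (e' b)) (p r : ℕ) :
    LocalInvariants.HasCoreRank inv (𝓕.induced e) p r ↔ LocalInvariants.HasCoreRank inv 𝓕 p r := by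
  unfold LocalInvariants.HasCoreRank
  rw [natCard_selmerGroup_induced_eq e e' 𝓕 hee' he'e,
    natCard_dualSelmerGroup_induced_eq e e' eD eD' inv 𝓕 hee' he'e heD heD']

omit [Finite M] [Finite Mbar] in
/-- `λ(𝓕̄) = λ(𝓕)` (T1). [cite: Sakamoto2024, §3.1.1 (p. 923)] -/
theorem selmerLambda_induced_eq (hee' : ∀ a, e' (e a) = a) (he'e : ∀ b, e (e' b) = b) (p : ℕ) :
    selmerLambda (𝓕.induced e) p = selmerLambda 𝓕 p := by
  unfold selmerLambda
  rw [natCard_selmerGroup_induced_eq e e' 𝓕 hee' he'e]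

/-- `λ^*(𝓕̄) = λ^*(𝓕)` (T2). [cite: Sakamoto2024, §3.1.1 (p. 923)] -/
theorem lambdaStar_induced_eq (hee' : ∀ a, e' (e a) = a) (he'e : ∀ b, e (e' b) = b)
    (heD : ∀ (f : TateDual K Mbar n) (a : M), eD f a = f (e a))
    (heD' : ∀ (g : TateDual K M n) (b : Mbar), eD' g b = g (e' b)) (p : ℕ) :
    LocalInvariants.lambdaStar inv (𝓕.induced e) p = LocalInvariants.lambdaStar inv 𝓕 p := by
  unfold LocalInvariants.lambdaStar
  rw [natCard_dualSelmerGroup_induced_eq e e' eD eD' inv 𝓕 hee' he'e heD heD']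

/-- `H¹_{𝓕̄^*} = 0 ↔ H¹_{𝓕^*} = 0` (`H¹(eD)` is a bijection between them).
[cite: Howard2004HeegnerKolyvagin, Def. 2.1.10 (arXiv:1202.6340 p. 6)] -/
theorem dualSelmerGroup_induced_eq_bot_iff (hee' : ∀ a, e' (e a) = a) (he'e : ∀ b, e (e' b) = b)
    (heD : ∀ (f : TateDual K Mbar n) (a : M), eD f a = f (e a))
    (heD' : ∀ (g : TateDual K M n) (b : Mbar), eD' g b = g (e' b)) :
    (inv.dualSelmerStructure ρbar (𝓕.induced e)).selmerGroup = ⊥ ↔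
      (inv.dualSelmerStructure ρ 𝓕).selmerGroup = ⊥ := by
  have h₂ : ∀ g, eD (eD' g) = g := dual_comp_eq_self e' e eD' eD hee' heD' heD
  simp only [AddSubgroup.eq_bot_iff_forall]
  refine ⟨fun h z hz => ?_, fun h y hy => ?_⟩
  · have hz' : galoisCohomology.map eD' 1 z ∈ (inv.dualSelmerStructure ρbar (𝓕.induced e)).selmerGroup := by
      rw [map_mem_dualSelmerGroup_induced_iff e eD inv 𝓕 heD, map_map_eq_self_of_comp_eq eD' eD h₂]
      exact hz
    have := h _ hz'
    rw [← map_map_eq_self_of_comp_eq eD' eD h₂ z, this, map_zero]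
  · have hy' := (map_mem_dualSelmerGroup_induced_iff e eD inv 𝓕 heD y).1 hy
    have h₁ : ∀ f, eD' (eD f) = f := dual_comp_eq_self e e' eD eD' he'e heD heD'
    rw [← map_map_eq_self_of_comp_eq eD eD' h₁ y, h _ hy', map_zero]

end Dual


end Summit.BirchSwinnertonDyer.Rank1Residual.GaloisImage.Transport

end
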